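import Literature.AlgebraicGeometry.Motives.HodgeStructureLefschetzGroupPowersInvariantsHodgeClasses
import Literature.AlgebraicGeometry.Motives.HodgeStructureExtendedLefschetzGroupPoints
import Literature.AlgebraicGeometry.Motives.HodgeStructureExteriorPowerDirectSum
import Literature.AlgebraicGeometry.Motives.HodgeStructureAbelianTypeDirectSum
import Literature.AlgebraicGeometry.Motives.HodgeStructureQuotient
import HarnessLib

/-!
# Milne 1999 §5 / §4 on the abstract carrier: pull-backs of Lefschetz classes are Lefschetz, the divisor classes
# `Dᵖ` and the Hodge classes `Bᵖ` of `⋀^• H` are functorial in the Hodge structure, "no exotic Hodge class" passes to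
# direct summands and is an isomorphism invariant, and Proposition 4.8 (b) ⟹ (a) on `ℂ`-points

[topic AlgebraicGeometry/Motives]

Layer `Literature/AlgebraicGeometry/Motives`, lane `lit-hodgefound` (Track 2 foundations library; prover seat `lit-hodgefound-p34`,
generation 26, row g26-#6). THEOREMS ONLY (no `def`, no named fact, net debt `0`). Sequel of the seat's g26-#1
`Motives/HodgeStructureLefschetzGroupInvariantsHodgeClasses` (Lefschetz `(1,1)` and Cor. 4.5 on the carrier: for a polarized
`ℚ`-Hodge structure `(H, Q)` of odd weight, `x ∈ Dᵖ(H) = H.divisorClasses p` iff `Θ x` is fixed by `S(H)(ℂ)`; Prop. 4.8 (c) ⟹ (a)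
for `H`), g26-#2 `…LefschetzGroupPowersInvariantsHodgeClasses` (the same for the powers `H^{⊕ι}`), of p02's
`Motives/HodgeStructureExteriorPowerDivisorClasses` (Lange's `Dᵖ ⊆ ⋀^{2p} V`, `D^{p+1} = Dᵖ ∧ B¹`, `Dᵖ ↪ ⋀ V` is `(B¹)ᵖ`),
`Motives/HodgeStructureExteriorPowerGeneralWeight` (`Hom.exteriorPower : (f : H₁ → H₂) ↦ ⋀ᵏ f`), and of the seat's g19
`Motives/HodgeStructureExtendedLefschetzGroupPoints` §7 (Prop. 4.8 (b) ⟺ (c) on `K`-points).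

## The sources, verbatim

J. S. Milne, *Lefschetz classes on abelian varieties*, Duke Math. J. 96 (1999) [Milne1999LefschetzClasses] (held text
`paper:doi-10-1215-s0012-7094-99-09620-5`), §5 p. 662 L14–L19: "A regular map `φ : X → Y` of smooth projective varieties
induces a homomorphism `φ^* : H^*(Y) → H^*(X)` of graded `k`-algebras […]. Because `φ^*` is a homomorphism of graded
`k`-algebras commuting with the cycle maps, it maps Lefschetz classes to Lefschetz classes. On the other hand, `φ_*` will not
in general map Lefschetz classes to Lefschetz classes." §4 p. 660: "A Hodge class not in `D_hom(A)` will be said to be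
*exotic*. **Proposition 4.8.** The following conditions on an abelian variety `A` are equivalent: (a) no power of `A` supports
an exotic Hodge class; (b) `Hg(A) = L(A)`; (c) `Hg′(A) = S(A)`", proof: "`H(A^r) = D(A^r)` for all `r ⟺ Hg(A) = L(A)`";
Remark 4.9: "When `A` has an isogeny factor of type III, the conditions in Proposition 4.8 always fail".
H. Lange, *Abelian Varieties over the Complex Numbers* (2023) [Lange2023AbelianVarietiesComplex], §7.3.1 (chunk p0336
L9–L11): `D^•(X)` "the subring of `H^{2•}_{Hodge}(X)` generated by `H⁰` and `H²_{Hodge}`" — p02's `divisorClasses`.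
K. Hulek, R. Laface, *On the Picard numbers of abelian varieties* (2019) [HulekLaface2019PicardNumbersAV], §2 Cor. 2.3 (chunk
p0005): "`ρ(A × B) ≥ ρ(A) + ρ(B)`" (monotonicity of the Picard number in a product).

## Reading on the carrier, and what is PROVED

A morphism of `ℚ`-Hodge structures `f : H₁ → H₂` of weight `n` (the tree's `HodgeStructure.Hom`; for abelian varieties the
PULL-BACK `φ^* : H¹(B, ℚ) → H¹(A, ℚ)` of a homomorphism `φ : A → B`, so that `⋀ᵏ f = φ^*` on `Hᵏ = ⋀ᵏ H¹`) induces the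
morphisms `⋀ᵏ f : ⋀ᵏ H₁ → ⋀ᵏ H₂` (p02's `Hom.exteriorPower`) and the graded `ℚ`-algebra map `⋀ f` (Mathlib's
`ExteriorAlgebra.map`); `Bᵏ_p(H) = Hdgᵖ(⋀ᵏ H)` (`(H.exteriorPower k).hodgeClasses p`), `B¹ = Hdgⁿ(⋀² H)`, `Dᵖ(H) = H.divisorClasses p`.

* §1 `⋀ᵏ f` versus `⋀ f` on submodules (`map_subtype_map_exteriorPower_map`); **`⋀ᵏ f (Bᵏ_p(H₁)) ⊆ Bᵏ_p(H₂)`**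
  (`Hom.map_exteriorPower_hodgeClasses_le`); **"`φ^*` maps Lefschetz classes to Lefschetz classes": `⋀^{2p} f (Dᵖ(H₁)) ⊆ Dᵖ(H₂)`**
  (`Hom.map_exteriorPower_divisorClasses_le` — `⋀ f` is an algebra map and `Dᵖ = (B¹)ᵖ` in `⋀ V`) and, at the level of the
  `ℚ`-algebras `D^•(H) = ℚ[B¹(H)] ⊆ ⋀ V` (Prop. 5.1 / g26-#4), **`⋀ f (ℚ[B¹(H₁)]) ⊆ ℚ[B¹(H₂)]`** (`Hom.map_adjoin_hodgeClasses_two_le`).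
* §2 RETRACTS. For morphisms `f : H₁ → H₂`, `s : H₂ → H₁` with `f ∘ s = id` (a direct summand `H₂` of `H₁`; an isomorphism):
  `⋀ᵏ f` maps `Bᵏ_p(H₁)` ONTO `Bᵏ_p(H₂)` and `Dᵖ(H₁)` ONTO `Dᵖ(H₂)` (`…_eq_of_comp_eq_id`); `y ∈ Bᵏ_p(H₂) ↔ ⋀ᵏ s y ∈ Bᵏ_p(H₁)`,
  `y ∈ Dᵖ(H₂) ↔ ⋀^{2p} s y ∈ Dᵖ(H₁)` (`…_iff_of_comp_eq_id`, `comap` forms); hence **"no exotic Hodge class in degree `2p`"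
  (`Dᵖ = Bᵖ`, with `Bᵖ = Hdg^{pn}(⋀^{2p} H)`) PASSES FROM `H₁` TO ITS RETRACT `H₂`** (`Hom.divisorClasses_eq_hodgeClasses_of_comp_eq_id`),
  an exotic class of `H₂` gives one of `H₁` (`Hom.exteriorPower_map_not_mem_divisorClasses_of_comp_eq_id`), and for a
  bijective morphism (an isomorphism of Hodge structures, the tree's `Hom.inverse`) `Dᵖ(H₁) = Bᵖ(H₁) ↔ Dᵖ(H₂) = Bᵖ(H₂)`
  (`Hom.divisorClasses_eq_hodgeClasses_iff_of_bijective`).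
* §3 DIMENSIONS: for an injective morphism `s : H₂ → H₁` (a sub-Hodge structure), `dim Bᵏ_p(H₂) ≤ dim Bᵏ_p(H₁)` and
  `dim Dᵖ(H₂) ≤ dim Dᵖ(H₁)` — in particular the Picard number `ρ = dim B¹` is monotone, "`ρ(A × B) ≥ ρ(A) + ρ(B)` ⊇ `ρ(A)`" —
  and both are invariants of the isomorphism class (`…_eq_of_bijective`).
* §4 DIRECT SUMS AND POWERS (`H₁ ⊕ H₂ = H₁.prod H₂`, `H^{⊕ι} = HodgeStructure.pi`; the projections, injections and the
  diagonal are morphisms, the tree's `Hom.prodFst/prodSnd/prodInl/prodInr/piProj/piLift`): `⋀(pr₁)` maps `Dᵖ(H₁ ⊕ H₂)` onto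
  `Dᵖ(H₁)`; `Dᵖ(H₁ ⊕ H₂) = Bᵖ ⟹ Dᵖ(H₁) = Bᵖ ∧ Dᵖ(H₂) = Bᵖ`; **`Dᵖ(H^{⊕ι}) = Bᵖ ⟹ Dᵖ(H) = Bᵖ`** (through the diagonal and a
  projection: "no power of `A` supports an exotic Hodge class" contains the case of `A`), `ρ(H₁) ≤ ρ(H₁ ⊕ H₂)`.
* §5 **Proposition 4.8 (b) ⟹ (a) on `ℂ`-points** (odd weight, `V ≠ 0`): if `MT(H)(ℂ) = G(H)(ℂ)` then `Dᵖ(H) = Bᵖ(H)` and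
  `Dᵖ(H^{⊕ι}) = Bᵖ(H^{⊕ι})` for every finite non-empty `ι` and every `p` (g19 §7 (b) ⟹ (c), then g26-#1/#2 (c) ⟹ (a)); and
  the contrapositives "an exotic Hodge class on some power forces `Hg(H)(ℂ) ≠ S(H)(ℂ)` and `MT(H)(ℂ) ≠ G(H)(ℂ)`" (Remark 4.9's
  "the conditions in Proposition 4.8 always fail" direction).

NOT here (scope): `φ_*` / Gysin maps and Cor. 5.5 (Poincaré duality on `⋀`, Prop. 5.4); Prop. 4.8 (a) ⟹ (b)/(c) (the groups
as the largest algebraic subgroups fixing their classes, Thm. 4.4 via Deligne 3.1 (c) — not a statement about one abstract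
point group); exterior powers of `HodgeStructure.pi` versus Künneth components (p02's `…ExteriorPowerDirectSum`, two summands).

## References

* [Milne1999LefschetzClasses] J. S. Milne, *Lefschetz classes on abelian varieties*, Duke Math. J. 96 (1999) 639–675, §4
  Prop. 4.8 and Remark 4.9 (p. 660), §5 p. 662 L14–L19 and Prop. 5.1.
* [Lange2023AbelianVarietiesComplex] H. Lange, *Abelian Varieties over the Complex Numbers*, Springer (2023), §7.3.1.
* [HulekLaface2019PicardNumbersAV] K. Hulek, R. Laface, *On the Picard numbers of abelian varieties*, Ann. Sc. Norm. Super. Pisa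
  (2019), §2 Prop. 2.2, Cor. 2.3.
* [VoisinHodgeI2002] C. Voisin, *Hodge Theory and Complex Algebraic Geometry I* (2002), §7.3.1 (morphisms of Hodge structures
  preserve Hodge classes; Lemma 7.23, a bijective morphism is an isomorphism).
-/

noncomputable section

open scoped TensorProduct

namespace Literature.AlgebraicGeometry.Motives

namespace HodgeStructure

open ExteriorLefschetz ExteriorAlgebra

universe u v w

/-! ## §1 Functoriality of `Bᵏ_p` and `Dᵖ` under morphisms of Hodge structures -/

section Functoriality

variable {V : Type u} [AddCommGroup V] [Module ℚ V] {W : Type v} [AddCommGroup W] [Module ℚ W]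

/-- `⋀ᵏ f` is the restriction of the algebra map `⋀ f` to `⋀ᵏ`, as an identity of linear maps into `⋀ W`.
[cite: BourbakiAlgebre1a3, Ch. III §7 no. 2 Prop. 2] -/
theorem subtype_comp_exteriorPower_map (f : V →ₗ[ℚ] W) (k : ℕ) :
    (⋀[ℚ]^k W).subtype ∘ₗ _root_.exteriorPower.map k f = (ExteriorAlgebra.map f).toLinearMap ∘ₗ (⋀[ℚ]^k V).subtype :=
  LinearMap.ext fun x ↦ coe_exteriorPower_map f x

/-- For a subspace `M ⊆ ⋀ᵏ V`: the image of `⋀ᵏ f (M)` in `⋀ W` is `⋀ f` of the image of `M` in `⋀ V`.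
[cite: BourbakiAlgebre1a3, Ch. III §7 no. 2 Prop. 2] -/
theorem map_subtype_map_exteriorPower_map (f : V →ₗ[ℚ] W) {k : ℕ} (M : Submodule ℚ (⋀[ℚ]^k V)) :
    (M.map (_root_.exteriorPower.map k f)).map (⋀[ℚ]^k W).subtype =
      (M.map (⋀[ℚ]^k V).subtype).map (ExteriorAlgebra.map f).toLinearMap := by
  rw [← Submodule.map_comp, subtype_comp_exteriorPower_map, Submodule.map_comp]

variable {n : ℤ} {H₁ : HodgeStructure V n} {H₂ : HodgeStructure W n}

/-- **`⋀ᵏ f` maps Hodge classes to Hodge classes**: `⋀ᵏ f (Hdgᵖ(⋀ᵏ H₁)) ⊆ Hdgᵖ(⋀ᵏ H₂)` for a morphism `f : H₁ → H₂`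
(`⋀ᵏ f` is a morphism of Hodge structures, p02's `Hom.exteriorPower`, and morphisms preserve Hodge classes).
[cite: VoisinHodgeI2002, §7.3.1 Def. 7.22] [cite: Huybrechts2016K3, Ch. 3 §1.1 (iv), (v)] -/
theorem Hom.map_exteriorPower_hodgeClasses_le (f : Hom H₁ H₂) (k : ℕ) (p : ℤ) :
    ((H₁.exteriorPower k).hodgeClasses p).map (_root_.exteriorPower.map k f.toLinearMap) ≤
      (H₂.exteriorPower k).hodgeClasses p :=
  (f.exteriorPower k).map_hodgeClasses_le p

/-- Elementwise: `x ∈ Hdgᵖ(⋀ᵏ H₁) ⟹ ⋀ᵏ f x ∈ Hdgᵖ(⋀ᵏ H₂)`. [cite: VoisinHodgeI2002, §7.3.1 Def. 7.22] -/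
theorem Hom.exteriorPower_map_mem_hodgeClasses (f : Hom H₁ H₂) {k : ℕ} {p : ℤ} {x : ⋀[ℚ]^k V}
    (hx : x ∈ (H₁.exteriorPower k).hodgeClasses p) :
    _root_.exteriorPower.map k f.toLinearMap x ∈ (H₂.exteriorPower k).hodgeClasses p :=
  f.map_exteriorPower_hodgeClasses_le k p ⟨x, hx, rfl⟩

/-- **"Because `φ^*` is a homomorphism of graded `k`-algebras commuting with the cycle maps, it maps Lefschetz classes to
Lefschetz classes"**, on the carrier: **`⋀^{2p} f (Dᵖ(H₁)) ⊆ Dᵖ(H₂)`** for every morphism of Hodge structures `f : H₁ → H₂` —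
`Dᵖ ↪ ⋀ V` is `(B¹)ᵖ` (p02), `⋀ f` is an algebra map with `⋀ f ((B¹(H₁))ᵖ) = (⋀² f (B¹(H₁)))ᵖ ⊆ (B¹(H₂))ᵖ`.
[cite: Milne1999LefschetzClasses, §5 p. 662 L14–L19] [cite: Lange2023AbelianVarietiesComplex, §7.3.1] -/
theorem Hom.map_exteriorPower_divisorClasses_le (f : Hom H₁ H₂) (p : ℕ) :
    (H₁.divisorClasses p).map (_root_.exteriorPower.map (2 * p) f.toLinearMap) ≤ H₂.divisorClasses p := by
  rw [← Submodule.map_le_map_iff_of_injective (⋀[ℚ]^(2 * p) W).injective_subtype, map_subtype_map_exteriorPower_map,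
    map_subtype_divisorClasses, map_subtype_divisorClasses, Submodule.map_pow]
  refine pow_le_pow_left' ?_ p
  rw [← map_subtype_map_exteriorPower_map]
  exact Submodule.map_mono (f.map_exteriorPower_hodgeClasses_le 2 n)

/-- Elementwise: `x ∈ Dᵖ(H₁) ⟹ ⋀^{2p} f x ∈ Dᵖ(H₂)` ("pull-backs of Lefschetz classes are Lefschetz").
[cite: Milne1999LefschetzClasses, §5 p. 662 L14–L19] -/
theorem Hom.exteriorPower_map_mem_divisorClasses (f : Hom H₁ H₂) {p : ℕ} {x : ⋀[ℚ]^(2 * p) V}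
    (hx : x ∈ H₁.divisorClasses p) :
    _root_.exteriorPower.map (2 * p) f.toLinearMap x ∈ H₂.divisorClasses p :=
  f.map_exteriorPower_divisorClasses_le p ⟨x, hx, rfl⟩

/-- **The algebra form: `⋀ f` maps the `ℚ`-algebra of Lefschetz classes `D^•(H₁) = ℚ[B¹(H₁)] ⊆ ⋀ V` into `ℚ[B¹(H₂)] ⊆ ⋀ W`**
("a homomorphism of graded `k`-algebras […] maps Lefschetz classes to Lefschetz classes"; `D^•` is the subalgebra generated by
`B¹`, Prop. 5.1 / g26-#4). [cite: Milne1999LefschetzClasses, §5 p. 662 L14–L19 and Prop. 5.1] -/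
theorem Hom.map_adjoin_hodgeClasses_two_le (f : Hom H₁ H₂) :
    (Algebra.adjoin ℚ (((H₁.exteriorPower 2).hodgeClasses n).map (⋀[ℚ]^2 V).subtype :
        Set (ExteriorAlgebra ℚ V))).map (ExteriorAlgebra.map f.toLinearMap) ≤
      Algebra.adjoin ℚ (((H₂.exteriorPower 2).hodgeClasses n).map (⋀[ℚ]^2 W).subtype : Set (ExteriorAlgebra ℚ W)) := by
  rw [AlgHom.map_adjoin]
  refine Algebra.adjoin_mono ?_
  rintro _ ⟨y, hy, rfl⟩
  obtain ⟨x, hx, rfl⟩ := (Submodule.mem_map.1 hy)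
  exact ⟨_root_.exteriorPower.map 2 f.toLinearMap x, f.exteriorPower_map_mem_hodgeClasses hx,
    coe_exteriorPower_map f.toLinearMap x⟩

end Functoriality

/-! ## §2 Retracts: direct summands and isomorphisms -/

section Retract

variable {V : Type u} [AddCommGroup V] [Module ℚ V] {W : Type v} [AddCommGroup W] [Module ℚ W] {n : ℤ}
  {H₁ : HodgeStructure V n} {H₂ : HodgeStructure W n}

/-- The underlying linear maps of a retraction pair compose to the identity. [folklore] -/
private theorem Hom.toLinearMap_comp_eq_id_of_comp_eq_id {f : Hom H₁ H₂} {s : Hom H₂ H₁} (hfs : f.comp s = Hom.id H₂) :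
    f.toLinearMap ∘ₗ s.toLinearMap = LinearMap.id :=
  congrArg Hom.toLinearMap hfs

/-- `⋀ᵏ f ∘ ⋀ᵏ s = id` for a retraction pair `f ∘ s = id`. [cite: BourbakiAlgebre1a3, Ch. III §7 no. 2 Prop. 2] -/
theorem Hom.exteriorPower_map_exteriorPower_map_of_comp_eq_id {f : Hom H₁ H₂} {s : Hom H₂ H₁}
    (hfs : f.comp s = Hom.id H₂) (k : ℕ) (y : ⋀[ℚ]^k W) :
    _root_.exteriorPower.map k f.toLinearMap (_root_.exteriorPower.map k s.toLinearMap y) = y := by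
  rw [← LinearMap.comp_apply, ← _root_.exteriorPower.map_comp, Hom.toLinearMap_comp_eq_id_of_comp_eq_id hfs,
    _root_.exteriorPower.map_id, LinearMap.id_apply]

/-- **A morphism with a section maps `Bᵏ_p(H₁)` ONTO `Bᵏ_p(H₂)`**: if `f ∘ s = id` (`H₂` a direct summand of `H₁`, or `f` an
isomorphism) then `⋀ᵏ f (Hdgᵖ(⋀ᵏ H₁)) = Hdgᵖ(⋀ᵏ H₂)` (every Hodge class `y` of `⋀ᵏ H₂` is `⋀ᵏ f` of the Hodge class `⋀ᵏ s y`).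
[cite: VoisinHodgeI2002, §7.3.1 Def. 7.22] -/
theorem Hom.map_exteriorPower_hodgeClasses_eq_of_comp_eq_id (f : Hom H₁ H₂) (s : Hom H₂ H₁) (hfs : f.comp s = Hom.id H₂)
    (k : ℕ) (p : ℤ) :
    ((H₁.exteriorPower k).hodgeClasses p).map (_root_.exteriorPower.map k f.toLinearMap) =
      (H₂.exteriorPower k).hodgeClasses p := by
  refine le_antisymm (f.map_exteriorPower_hodgeClasses_le k p) fun y hy ↦ ?_
  exact ⟨_root_.exteriorPower.map k s.toLinearMap y, s.exteriorPower_map_mem_hodgeClasses hy,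
    Hom.exteriorPower_map_exteriorPower_map_of_comp_eq_id hfs k y⟩

/-- **A morphism with a section maps `Dᵖ(H₁)` ONTO `Dᵖ(H₂)`**: if `f ∘ s = id` then `⋀^{2p} f (Dᵖ(H₁)) = Dᵖ(H₂)` — every
Lefschetz class of a direct summand is the restriction of a Lefschetz class. [cite: Milne1999LefschetzClasses, §5 p. 662 L14–L19] -/
theorem Hom.map_exteriorPower_divisorClasses_eq_of_comp_eq_id (f : Hom H₁ H₂) (s : Hom H₂ H₁) (hfs : f.comp s = Hom.id H₂)
    (p : ℕ) :
    (H₁.divisorClasses p).map (_root_.exteriorPower.map (2 * p) f.toLinearMap) = H₂.divisorClasses p := by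
  refine le_antisymm (f.map_exteriorPower_divisorClasses_le p) fun y hy ↦ ?_
  exact ⟨_root_.exteriorPower.map (2 * p) s.toLinearMap y, s.exteriorPower_map_mem_divisorClasses hy,
    Hom.exteriorPower_map_exteriorPower_map_of_comp_eq_id hfs (2 * p) y⟩

/-- **For the section `s` of a retraction pair `f ∘ s = id`: `⋀ᵏ s y` is a Hodge class of `⋀ᵏ H₁` iff `y` is a Hodge class of
`⋀ᵏ H₂`** (apply `⋀ᵏ f`). [cite: VoisinHodgeI2002, §7.3.1 Def. 7.22] -/
theorem Hom.exteriorPower_map_mem_hodgeClasses_iff_of_comp_eq_id (f : Hom H₁ H₂) (s : Hom H₂ H₁) (hfs : f.comp s = Hom.id H₂)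
    {k : ℕ} {p : ℤ} (y : ⋀[ℚ]^k W) :
    _root_.exteriorPower.map k s.toLinearMap y ∈ (H₁.exteriorPower k).hodgeClasses p ↔
      y ∈ (H₂.exteriorPower k).hodgeClasses p := by
  refine ⟨fun h ↦ ?_, fun h ↦ s.exteriorPower_map_mem_hodgeClasses h⟩
  have h' := f.exteriorPower_map_mem_hodgeClasses h
  rwa [Hom.exteriorPower_map_exteriorPower_map_of_comp_eq_id hfs k y] at h'

/-- **For the section `s` of a retraction pair `f ∘ s = id`: `⋀^{2p} s y ∈ Dᵖ(H₁)` iff `y ∈ Dᵖ(H₂)`** — a class of a direct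
summand is Lefschetz iff its pull-back to the whole is ("`φ^*` maps Lefschetz classes to Lefschetz classes", both ways along
`f` and `s`). [cite: Milne1999LefschetzClasses, §5 p. 662 L14–L19] -/
theorem Hom.exteriorPower_map_mem_divisorClasses_iff_of_comp_eq_id (f : Hom H₁ H₂) (s : Hom H₂ H₁) (hfs : f.comp s = Hom.id H₂)
    {p : ℕ} (y : ⋀[ℚ]^(2 * p) W) :
    _root_.exteriorPower.map (2 * p) s.toLinearMap y ∈ H₁.divisorClasses p ↔ y ∈ H₂.divisorClasses p := by
  refine ⟨fun h ↦ ?_, fun h ↦ s.exteriorPower_map_mem_divisorClasses h⟩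
  have h' := f.exteriorPower_map_mem_divisorClasses h
  rwa [Hom.exteriorPower_map_exteriorPower_map_of_comp_eq_id hfs (2 * p) y] at h'

/-- The `comap` form: `(⋀ᵏ s)⁻¹ (Hdgᵖ(⋀ᵏ H₁)) = Hdgᵖ(⋀ᵏ H₂)` for the section `s` of a retraction pair.
[cite: VoisinHodgeI2002, §7.3.1 Def. 7.22] -/
theorem Hom.comap_exteriorPower_hodgeClasses_eq_of_comp_eq_id (f : Hom H₁ H₂) (s : Hom H₂ H₁) (hfs : f.comp s = Hom.id H₂)
    (k : ℕ) (p : ℤ) :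
    ((H₁.exteriorPower k).hodgeClasses p).comap (_root_.exteriorPower.map k s.toLinearMap) =
      (H₂.exteriorPower k).hodgeClasses p :=
  Submodule.ext fun y ↦ f.exteriorPower_map_mem_hodgeClasses_iff_of_comp_eq_id s hfs y

/-- The `comap` form: `(⋀^{2p} s)⁻¹ (Dᵖ(H₁)) = Dᵖ(H₂)` for the section `s` of a retraction pair.
[cite: Milne1999LefschetzClasses, §5 p. 662 L14–L19] -/
theorem Hom.comap_exteriorPower_divisorClasses_eq_of_comp_eq_id (f : Hom H₁ H₂) (s : Hom H₂ H₁) (hfs : f.comp s = Hom.id H₂)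
    (p : ℕ) :
    (H₁.divisorClasses p).comap (_root_.exteriorPower.map (2 * p) s.toLinearMap) = H₂.divisorClasses p :=
  Submodule.ext fun y ↦ f.exteriorPower_map_mem_divisorClasses_iff_of_comp_eq_id s hfs y

/-- **"No exotic Hodge class in degree `2p`" passes to retracts**: if `f ∘ s = id` and `Dᵖ(H₁) = Bᵖ(H₁)`
(`Bᵖ = Hdg^{pn}(⋀^{2p} H)`: every Hodge class of `⋀^{2p} H₁` of type `(pn, pn)` is Lefschetz) then `Dᵖ(H₂) = Bᵖ(H₂)` — a Hodge
class `y` of the summand pulls back to the Hodge class `⋀^{2p} s y`, which is Lefschetz, so `y` is (previous theorem).  In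
Milne's (a) "no power of `A` supports an exotic Hodge class", the factors and the isomorphic copies of `A` inherit the property.
[cite: Milne1999LefschetzClasses, §4 Prop. 4.8 and §5 p. 662 L14–L19] -/
theorem Hom.divisorClasses_eq_hodgeClasses_of_comp_eq_id (f : Hom H₁ H₂) (s : Hom H₂ H₁) (hfs : f.comp s = Hom.id H₂)
    {p : ℕ} (h₁ : H₁.divisorClasses p = (H₁.exteriorPower (2 * p)).hodgeClasses (p * n)) :
    H₂.divisorClasses p = (H₂.exteriorPower (2 * p)).hodgeClasses (p * n) := by
  refine le_antisymm (H₂.divisorClasses_le_hodgeClasses p) fun y hy ↦ ?_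
  rw [← f.exteriorPower_map_mem_divisorClasses_iff_of_comp_eq_id s hfs y, h₁]
  exact s.exteriorPower_map_mem_hodgeClasses hy

/-- **An exotic Hodge class of a retract gives an exotic Hodge class of the whole**: if `f ∘ s = id` and `y ∈ Bᵖ(H₂) ∖ Dᵖ(H₂)`
then `⋀^{2p} s y ∈ Bᵖ(H₁) ∖ Dᵖ(H₁)`. [cite: Milne1999LefschetzClasses, §4 p. 660 (exotic classes) and §5 p. 662 L14–L19] -/
theorem Hom.exteriorPower_map_not_mem_divisorClasses_of_comp_eq_id (f : Hom H₁ H₂) (s : Hom H₂ H₁) (hfs : f.comp s = Hom.id H₂)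
    {p : ℕ} {y : ⋀[ℚ]^(2 * p) W} (hyB : y ∈ (H₂.exteriorPower (2 * p)).hodgeClasses (p * n)) (hyD : y ∉ H₂.divisorClasses p) :
    _root_.exteriorPower.map (2 * p) s.toLinearMap y ∈ (H₁.exteriorPower (2 * p)).hodgeClasses (p * n) ∧
      _root_.exteriorPower.map (2 * p) s.toLinearMap y ∉ H₁.divisorClasses p :=
  ⟨s.exteriorPower_map_mem_hodgeClasses hyB, fun h ↦ hyD ((f.exteriorPower_map_mem_divisorClasses_iff_of_comp_eq_id s hfs y).1 h)⟩

/-! ### Isomorphisms (bijective morphisms; the tree's `Hom.inverse`) -/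

/-- **An isomorphism of Hodge structures identifies the Hodge classes of the exterior powers**: for a bijective morphism `f`,
`⋀ᵏ f (Hdgᵖ(⋀ᵏ H₁)) = Hdgᵖ(⋀ᵏ H₂)`. [cite: VoisinHodgeI2002, §7.3.1 Lemma 7.23] -/
theorem Hom.map_exteriorPower_hodgeClasses_eq_of_bijective (f : Hom H₁ H₂) (hf : Function.Bijective f.toLinearMap) (k : ℕ)
    (p : ℤ) :
    ((H₁.exteriorPower k).hodgeClasses p).map (_root_.exteriorPower.map k f.toLinearMap) =
      (H₂.exteriorPower k).hodgeClasses p :=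
  f.map_exteriorPower_hodgeClasses_eq_of_comp_eq_id (f.inverse hf) (f.comp_inverse hf) k p

/-- **An isomorphism of Hodge structures identifies the divisor classes**: `⋀^{2p} f (Dᵖ(H₁)) = Dᵖ(H₂)` for `f` bijective.
[cite: Milne1999LefschetzClasses, §5 p. 662 L14–L19] [cite: VoisinHodgeI2002, §7.3.1 Lemma 7.23] -/
theorem Hom.map_exteriorPower_divisorClasses_eq_of_bijective (f : Hom H₁ H₂) (hf : Function.Bijective f.toLinearMap) (p : ℕ) :
    (H₁.divisorClasses p).map (_root_.exteriorPower.map (2 * p) f.toLinearMap) = H₂.divisorClasses p :=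
  f.map_exteriorPower_divisorClasses_eq_of_comp_eq_id (f.inverse hf) (f.comp_inverse hf) p

/-- **"No exotic Hodge class in degree `2p`" is an isomorphism invariant**: for a bijective morphism `f : H₁ → H₂`,
`Dᵖ(H₁) = Bᵖ(H₁) ↔ Dᵖ(H₂) = Bᵖ(H₂)`. [cite: Milne1999LefschetzClasses, §4 Prop. 4.8 (p. 660)] [cite: VoisinHodgeI2002, §7.3.1 Lemma 7.23] -/
theorem Hom.divisorClasses_eq_hodgeClasses_iff_of_bijective (f : Hom H₁ H₂) (hf : Function.Bijective f.toLinearMap) {p : ℕ} :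
    H₁.divisorClasses p = (H₁.exteriorPower (2 * p)).hodgeClasses (p * n) ↔
      H₂.divisorClasses p = (H₂.exteriorPower (2 * p)).hodgeClasses (p * n) :=
  ⟨f.divisorClasses_eq_hodgeClasses_of_comp_eq_id (f.inverse hf) (f.comp_inverse hf),
    (f.inverse hf).divisorClasses_eq_hodgeClasses_of_comp_eq_id f (f.inverse_comp hf)⟩

end Retract

/-! ## §3 Dimensions: sub-Hodge structures and isomorphisms -/

section Finrank

variable {V : Type u} [AddCommGroup V] [Module ℚ V] {W : Type v} [AddCommGroup W] [Module ℚ W] {n : ℤ}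
  {H₁ : HodgeStructure V n} {H₂ : HodgeStructure W n}

/-- **`dim Hdgᵖ(⋀ᵏ H₂) ≤ dim Hdgᵖ(⋀ᵏ H₁)` for an injective morphism `s : H₂ → H₁`** (a sub-Hodge structure; `⋀ᵏ s` is
injective over a field and maps Hodge classes to Hodge classes) — for `k = 2`, `p = n` the Picard number `ρ = dim B¹` is
monotone: "`ρ(A × B) ≥ ρ(A) + ρ(B)`", in particular `ρ(A) ≤ ρ(A × B)`. [cite: HulekLaface2019PicardNumbersAV, §2 Cor. 2.3]
[cite: VoisinHodgeI2002, §7.3.1 Def. 7.22] -/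
theorem Hom.finrank_hodgeClasses_exteriorPower_le_of_injective [Module.Finite ℚ V] (s : Hom H₂ H₁)
    (hs : Function.Injective s.toLinearMap) (k : ℕ) (p : ℤ) :
    Module.finrank ℚ ((H₂.exteriorPower k).hodgeClasses p) ≤ Module.finrank ℚ ((H₁.exteriorPower k).hodgeClasses p) :=
  calc Module.finrank ℚ ((H₂.exteriorPower k).hodgeClasses p)
      = Module.finrank ℚ (((H₂.exteriorPower k).hodgeClasses p).map (_root_.exteriorPower.map k s.toLinearMap)) :=
        (Submodule.equivMapOfInjective _ (_root_.exteriorPower.map_injective_field hs) _).finrank_eq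
    _ ≤ Module.finrank ℚ ((H₁.exteriorPower k).hodgeClasses p) := Submodule.finrank_mono (s.map_exteriorPower_hodgeClasses_le k p)

/-- **`dim Dᵖ(H₂) ≤ dim Dᵖ(H₁)` for an injective morphism `s : H₂ → H₁`** (`⋀^{2p} s` is injective and maps `Dᵖ` into `Dᵖ`).
[cite: Milne1999LefschetzClasses, §5 p. 662 L14–L19] [cite: HulekLaface2019PicardNumbersAV, §2 Cor. 2.3] -/
theorem Hom.finrank_divisorClasses_le_of_injective [Module.Finite ℚ V] (s : Hom H₂ H₁) (hs : Function.Injective s.toLinearMap)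
    (p : ℕ) :
    Module.finrank ℚ (H₂.divisorClasses p) ≤ Module.finrank ℚ (H₁.divisorClasses p) :=
  calc Module.finrank ℚ (H₂.divisorClasses p)
      = Module.finrank ℚ ((H₂.divisorClasses p).map (_root_.exteriorPower.map (2 * p) s.toLinearMap)) :=
        (Submodule.equivMapOfInjective _ (_root_.exteriorPower.map_injective_field hs) _).finrank_eq
    _ ≤ Module.finrank ℚ (H₁.divisorClasses p) := Submodule.finrank_mono (s.map_exteriorPower_divisorClasses_le p)

/-- **`dim Hdgᵖ(⋀ᵏ H)` is an isomorphism invariant** (in particular the Picard number `ρ = dim Hdgⁿ(⋀² H)`): for a bijective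
morphism `f : H₁ → H₂`, `dim Hdgᵖ(⋀ᵏ H₁) = dim Hdgᵖ(⋀ᵏ H₂)`. [cite: VoisinHodgeI2002, §7.3.1 Lemma 7.23] -/
theorem Hom.finrank_hodgeClasses_exteriorPower_eq_of_bijective (f : Hom H₁ H₂) (hf : Function.Bijective f.toLinearMap) (k : ℕ)
    (p : ℤ) :
    Module.finrank ℚ ((H₁.exteriorPower k).hodgeClasses p) = Module.finrank ℚ ((H₂.exteriorPower k).hodgeClasses p) :=
  ((Submodule.equivMapOfInjective _
      (_root_.exteriorPower.map_injective _ (Hom.toLinearMap_comp_eq_id_of_comp_eq_id (f.inverse_comp hf))) _).trans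
    (LinearEquiv.ofEq _ _ (f.map_exteriorPower_hodgeClasses_eq_of_bijective hf k p))).finrank_eq

/-- **`dim Dᵖ(H)` is an isomorphism invariant**: for a bijective morphism `f : H₁ → H₂`, `dim Dᵖ(H₁) = dim Dᵖ(H₂)`.
[cite: Milne1999LefschetzClasses, §5 p. 662 L14–L19] [cite: VoisinHodgeI2002, §7.3.1 Lemma 7.23] -/
theorem Hom.finrank_divisorClasses_eq_of_bijective (f : Hom H₁ H₂) (hf : Function.Bijective f.toLinearMap) (p : ℕ) :
    Module.finrank ℚ (H₁.divisorClasses p) = Module.finrank ℚ (H₂.divisorClasses p) :=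
  ((Submodule.equivMapOfInjective _
      (_root_.exteriorPower.map_injective _ (Hom.toLinearMap_comp_eq_id_of_comp_eq_id (f.inverse_comp hf))) _).trans
    (LinearEquiv.ofEq _ _ (f.map_exteriorPower_divisorClasses_eq_of_bijective hf p))).finrank_eq

end Finrank

/-! ## §4 Direct sums and powers -/

section DirectSum

variable {V : Type u} [AddCommGroup V] [Module ℚ V] {W : Type v} [AddCommGroup W] [Module ℚ W] {n : ℤ}
  (H₁ : HodgeStructure V n) (H₂ : HodgeStructure W n)

/-- `pr₁ ∘ in₁ = id` as morphisms of Hodge structures. [cite: DeligneHodgeII1971, 2.1] -/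
theorem Hom.prodFst_comp_prodInl : (Hom.prodFst H₁ H₂).comp (Hom.prodInl H₁ H₂) = Hom.id H₁ :=
  Hom.ext (LinearMap.ext fun _ ↦ rfl)

/-- `pr₂ ∘ in₂ = id` as morphisms of Hodge structures. [cite: DeligneHodgeII1971, 2.1] -/
theorem Hom.prodSnd_comp_prodInr : (Hom.prodSnd H₁ H₂).comp (Hom.prodInr H₁ H₂) = Hom.id H₂ :=
  Hom.ext (LinearMap.ext fun _ ↦ rfl)

/-- **`⋀(pr₁)` maps `Dᵖ(H₁ ⊕ H₂)` ONTO `Dᵖ(H₁)`** (every Lefschetz class of a factor is the restriction of a Lefschetz class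
of the sum, namely of its pull-back along `pr₁`). [cite: Milne1999LefschetzClasses, §5 p. 662 L14–L19] -/
theorem map_fst_divisorClasses_prod (p : ℕ) :
    ((H₁.prod H₂).divisorClasses p).map (_root_.exteriorPower.map (2 * p) (LinearMap.fst ℚ V W)) = H₁.divisorClasses p :=
  (Hom.prodFst H₁ H₂).map_exteriorPower_divisorClasses_eq_of_comp_eq_id (Hom.prodInl H₁ H₂) (Hom.prodFst_comp_prodInl H₁ H₂) p

/-- **`⋀(pr₂)` maps `Dᵖ(H₁ ⊕ H₂)` ONTO `Dᵖ(H₂)`.** [cite: Milne1999LefschetzClasses, §5 p. 662 L14–L19] -/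
theorem map_snd_divisorClasses_prod (p : ℕ) :
    ((H₁.prod H₂).divisorClasses p).map (_root_.exteriorPower.map (2 * p) (LinearMap.snd ℚ V W)) = H₂.divisorClasses p :=
  (Hom.prodSnd H₁ H₂).map_exteriorPower_divisorClasses_eq_of_comp_eq_id (Hom.prodInr H₁ H₂) (Hom.prodSnd_comp_prodInr H₁ H₂) p

/-- **A class `y` of the factor `H₁` is Lefschetz iff `⋀(in₁) y` is a Lefschetz class of `H₁ ⊕ H₂`.**
[cite: Milne1999LefschetzClasses, §5 p. 662 L14–L19] -/
theorem exteriorPower_map_inl_mem_divisorClasses_iff {p : ℕ} (y : ⋀[ℚ]^(2 * p) V) :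
    _root_.exteriorPower.map (2 * p) (LinearMap.inl ℚ V W) y ∈ (H₁.prod H₂).divisorClasses p ↔ y ∈ H₁.divisorClasses p :=
  (Hom.prodFst H₁ H₂).exteriorPower_map_mem_divisorClasses_iff_of_comp_eq_id (Hom.prodInl H₁ H₂)
    (Hom.prodFst_comp_prodInl H₁ H₂) y

/-- **A class `y` of the factor `H₂` is Lefschetz iff `⋀(in₂) y` is a Lefschetz class of `H₁ ⊕ H₂`.**
[cite: Milne1999LefschetzClasses, §5 p. 662 L14–L19] -/
theorem exteriorPower_map_inr_mem_divisorClasses_iff {p : ℕ} (y : ⋀[ℚ]^(2 * p) W) :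
    _root_.exteriorPower.map (2 * p) (LinearMap.inr ℚ V W) y ∈ (H₁.prod H₂).divisorClasses p ↔ y ∈ H₂.divisorClasses p :=
  (Hom.prodSnd H₁ H₂).exteriorPower_map_mem_divisorClasses_iff_of_comp_eq_id (Hom.prodInr H₁ H₂)
    (Hom.prodSnd_comp_prodInr H₁ H₂) y

/-- **No exotic Hodge class on `H₁ ⊕ H₂` in degree `2p` ⟹ none on `H₁` and none on `H₂`** (both are retracts of the sum).
[cite: Milne1999LefschetzClasses, §4 Prop. 4.8 (p. 660) and §5 p. 662 L14–L19] -/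
theorem divisorClasses_eq_hodgeClasses_of_prod {p : ℕ}
    (h : (H₁.prod H₂).divisorClasses p = ((H₁.prod H₂).exteriorPower (2 * p)).hodgeClasses (p * n)) :
    H₁.divisorClasses p = (H₁.exteriorPower (2 * p)).hodgeClasses (p * n) ∧
      H₂.divisorClasses p = (H₂.exteriorPower (2 * p)).hodgeClasses (p * n) :=
  ⟨(Hom.prodFst H₁ H₂).divisorClasses_eq_hodgeClasses_of_comp_eq_id (Hom.prodInl H₁ H₂) (Hom.prodFst_comp_prodInl H₁ H₂) h,
    (Hom.prodSnd H₁ H₂).divisorClasses_eq_hodgeClasses_of_comp_eq_id (Hom.prodInr H₁ H₂) (Hom.prodSnd_comp_prodInr H₁ H₂) h⟩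

/-- **`ρ`-monotonicity in a direct sum, all degrees: `dim Hdgᵖ(⋀ᵏ H₁) ≤ dim Hdgᵖ(⋀ᵏ(H₁ ⊕ H₂))`** ("`ρ(A × B) ≥ ρ(A) + ρ(B)`" ⊇
`ρ(A) ≤ ρ(A × B)`). [cite: HulekLaface2019PicardNumbersAV, §2 Cor. 2.3] -/
theorem finrank_hodgeClasses_exteriorPower_le_prod [Module.Finite ℚ V] [Module.Finite ℚ W] (k : ℕ) (p : ℤ) :
    Module.finrank ℚ ((H₁.exteriorPower k).hodgeClasses p) ≤ Module.finrank ℚ (((H₁.prod H₂).exteriorPower k).hodgeClasses p) :=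
  (Hom.prodInl H₁ H₂).finrank_hodgeClasses_exteriorPower_le_of_injective LinearMap.inl_injective k p

/-- **`dim Dᵖ(H₁) ≤ dim Dᵖ(H₁ ⊕ H₂)`.** [cite: HulekLaface2019PicardNumbersAV, §2 Cor. 2.3] [cite: Milne1999LefschetzClasses, §5 p. 662 L14–L19] -/
theorem finrank_divisorClasses_le_prod [Module.Finite ℚ V] [Module.Finite ℚ W] (p : ℕ) :
    Module.finrank ℚ (H₁.divisorClasses p) ≤ Module.finrank ℚ ((H₁.prod H₂).divisorClasses p) :=
  (Hom.prodInl H₁ H₂).finrank_divisorClasses_le_of_injective LinearMap.inl_injective p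

variable {ι : Type w} [Fintype ι] [DecidableEq ι] (H : HodgeStructure V n)

/-- `pr_j ∘ Δ = id` for the diagonal `Δ : H → H^{⊕ι}` and a coordinate projection. [cite: DeligneHodgeII1971, 2.1] -/
theorem Hom.piProj_comp_piLift_id (j : ι) :
    (Hom.piProj (fun _ : ι ↦ H) j).comp (Hom.piLift fun _ : ι ↦ Hom.id H) = Hom.id H :=
  Hom.ext (LinearMap.ext fun _ ↦ rfl)

/-- **No exotic Hodge class on the power `H^{⊕ι}` in degree `2p` ⟹ none on `H`** (`ι` non-empty: `H` is a retract of
`H^{⊕ι}` through the diagonal and a projection) — "no power of `A` supports an exotic Hodge class" contains the case `r = 1`.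
[cite: Milne1999LefschetzClasses, §4 Prop. 4.8 (p. 660)] -/
theorem divisorClasses_eq_hodgeClasses_of_pi (j : ι) {p : ℕ}
    (h : (HodgeStructure.pi fun _ : ι ↦ H).divisorClasses p =
      ((HodgeStructure.pi fun _ : ι ↦ H).exteriorPower (2 * p)).hodgeClasses (p * n)) :
    H.divisorClasses p = (H.exteriorPower (2 * p)).hodgeClasses (p * n) :=
  (Hom.piProj (fun _ : ι ↦ H) j).divisorClasses_eq_hodgeClasses_of_comp_eq_id (Hom.piLift fun _ : ι ↦ Hom.id H)
    (Hom.piProj_comp_piLift_id H j) h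

/-- **An exotic Hodge class on `H` gives one on every power `H^{⊕ι}`** (`ι` non-empty): its image under `⋀` of the diagonal.
[cite: Milne1999LefschetzClasses, §4 p. 660 (exotic classes), Remark 4.9] -/
theorem exists_not_mem_divisorClasses_pi_of_not_mem (j : ι) {p : ℕ} {y : ⋀[ℚ]^(2 * p) V}
    (hyB : y ∈ (H.exteriorPower (2 * p)).hodgeClasses (p * n)) (hyD : y ∉ H.divisorClasses p) :
    ∃ x ∈ ((HodgeStructure.pi fun _ : ι ↦ H).exteriorPower (2 * p)).hodgeClasses (p * n),
      x ∉ (HodgeStructure.pi fun _ : ι ↦ H).divisorClasses p := by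
  have h := (Hom.piProj (fun _ : ι ↦ H) j).exteriorPower_map_not_mem_divisorClasses_of_comp_eq_id
    (Hom.piLift fun _ : ι ↦ Hom.id H) (Hom.piProj_comp_piLift_id H j) hyB hyD
  exact ⟨_, h.1, h.2⟩

end DirectSum

/-! ## §5 Proposition 4.8 (b) ⟹ (a) on `ℂ`-points -/

section PropositionFourEight

variable {V : Type u} [AddCommGroup V] [Module ℚ V] [Module.Finite ℚ V] [HodgeTensorFacts.{u, u}] [Nontrivial V] {n : ℤ}
  {H : HodgeStructure V n} (Q : Polarization H)

/-- **Proposition 4.8, (b) ⟹ (a) for `A` itself, on `ℂ`-points (odd weight, `V ≠ 0`)**: if `MT(H)(ℂ) = G(H)(ℂ)`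
("`Hg(A) = L(A)`") then `Dᵖ(H) = Bᵖ(H) = Hdg^{pn}(⋀^{2p} H)` for every `p` — no exotic Hodge class on `A` ((b) ⟹ (c) on points,
g19 §7, then (c) ⟹ (a), g26-#1). [cite: Milne1999LefschetzClasses, §4 Prop. 4.8 (p. 660)] -/
theorem Polarization.divisorClasses_eq_hodgeClasses_of_mumfordTateGroupBaseChange_eq (hn : Odd n)
    (hMT : H.mumfordTateGroupBaseChange ℂ = Q.lefschetzSimilitudeGroupBaseChange ℂ) (p : ℕ) :
    H.divisorClasses p = (H.exteriorPower (2 * p)).hodgeClasses (p * n) :=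
  Q.divisorClasses_eq_hodgeClasses_of_hodgeGroupBaseChange_eq hn
    (Q.hodgeGroupBaseChange_eq_lefschetzGroupBaseChange_of_eq ℂ hn hMT) p

/-- **Proposition 4.8, (b) ⟹ (a), on `ℂ`-points (odd weight, `V ≠ 0`): if `MT(H)(ℂ) = G(H)(ℂ)` then NO POWER `H^{⊕ι}`
supports an exotic Hodge class** — `Dᵖ(H^{⊕ι}) = Bᵖ(H^{⊕ι})` for every finite non-empty `ι` and every `p` ((b) ⟹ (c) on points,
then g26-#2's (c) ⟹ (a) for the powers). [cite: Milne1999LefschetzClasses, §4 Prop. 4.8 (p. 660)] -/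
theorem Polarization.divisorClasses_pi_eq_hodgeClasses_of_mumfordTateGroupBaseChange_eq {ι : Type} [Fintype ι]
    [DecidableEq ι] [Nonempty ι] (hn : Odd n) (hMT : H.mumfordTateGroupBaseChange ℂ = Q.lefschetzSimilitudeGroupBaseChange ℂ)
    (p : ℕ) :
    (HodgeStructure.pi fun _ : ι ↦ H).divisorClasses p =
      ((HodgeStructure.pi fun _ : ι ↦ H).exteriorPower (2 * p)).hodgeClasses (p * n) :=
  Q.divisorClasses_pi_eq_hodgeClasses_of_hodgeGroupBaseChange_eq hn
    (Q.hodgeGroupBaseChange_eq_lefschetzGroupBaseChange_of_eq ℂ hn hMT) p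

/-- **Weight one** (`H = H¹(A, ℚ)`, `H^{⊕ι} = H¹(A^r, ℚ)`, `Bᵖ(A^r) = Hdgᵖ(H^{2p}(A^r, ℚ))`): `MT(A)(ℂ) = G(A)(ℂ) ⟹ Dᵖ(A^r) = Bᵖ(A^r)`
for all `r ≥ 1` and all `p`. [cite: Milne1999LefschetzClasses, §4 Prop. 4.8 (p. 660)] -/
theorem Polarization.divisorClasses_pi_eq_hodgeClasses_weightOne_of_mumfordTateGroupBaseChange_eq {H : HodgeStructure V 1}
    (Q : Polarization H) {ι : Type} [Fintype ι] [DecidableEq ι] [Nonempty ι]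
    (hMT : H.mumfordTateGroupBaseChange ℂ = Q.lefschetzSimilitudeGroupBaseChange ℂ) (p : ℕ) :
    (HodgeStructure.pi fun _ : ι ↦ H).divisorClasses p =
      ((HodgeStructure.pi fun _ : ι ↦ H).exteriorPower (2 * p)).hodgeClasses p := by
  simpa using Q.divisorClasses_pi_eq_hodgeClasses_of_mumfordTateGroupBaseChange_eq odd_one hMT p

omit [Nontrivial V] in
/-- **An exotic Hodge class on some power forces `Hg(H)(ℂ) ≠ S(H)(ℂ)`** (odd weight; contrapositive of g26-#2's (c) ⟹ (a) —
the direction of Remark 4.9 "the conditions in Proposition 4.8 always fail"). [cite: Milne1999LefschetzClasses, §4 Prop. 4.8, Remark 4.9 (p. 660)] -/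
theorem Polarization.hodgeGroupBaseChange_ne_lefschetzGroupBaseChange_of_not_mem_divisorClasses {ι : Type} [Fintype ι]
    [DecidableEq ι] [Nonempty ι] (hn : Odd n) {p : ℕ} {x : ⋀[ℚ]^(2 * p) (ι → V)}
    (hxB : x ∈ ((HodgeStructure.pi fun _ : ι ↦ H).exteriorPower (2 * p)).hodgeClasses (p * n))
    (hxD : x ∉ (HodgeStructure.pi fun _ : ι ↦ H).divisorClasses p) :
    H.hodgeGroupBaseChange ℂ ≠ Q.lefschetzGroupBaseChange ℂ := fun h ↦
  hxD ((Q.divisorClasses_pi_eq_hodgeClasses_of_hodgeGroupBaseChange_eq (ι := ι) hn h p).symm ▸ hxB)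

/-- **An exotic Hodge class on some power forces `MT(H)(ℂ) ≠ G(H)(ℂ)`** ("`Hg(A) ≠ L(A)`"; odd weight, `V ≠ 0`).
[cite: Milne1999LefschetzClasses, §4 Prop. 4.8, Remark 4.9 (p. 660)] -/
theorem Polarization.mumfordTateGroupBaseChange_ne_lefschetzSimilitudeGroupBaseChange_of_not_mem_divisorClasses {ι : Type}
    [Fintype ι] [DecidableEq ι] [Nonempty ι] (hn : Odd n) {p : ℕ} {x : ⋀[ℚ]^(2 * p) (ι → V)}
    (hxB : x ∈ ((HodgeStructure.pi fun _ : ι ↦ H).exteriorPower (2 * p)).hodgeClasses (p * n))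
    (hxD : x ∉ (HodgeStructure.pi fun _ : ι ↦ H).divisorClasses p) :
    H.mumfordTateGroupBaseChange ℂ ≠ Q.lefschetzSimilitudeGroupBaseChange ℂ := fun h ↦
  hxD ((Q.divisorClasses_pi_eq_hodgeClasses_of_mumfordTateGroupBaseChange_eq (ι := ι) hn h p).symm ▸ hxB)

/-- **An exotic Hodge class on `H` itself forces `Hg(H)(ℂ) ≠ S(H)(ℂ)` and `MT(H)(ℂ) ≠ G(H)(ℂ)`** (odd weight, `V ≠ 0`).
[cite: Milne1999LefschetzClasses, §4 Prop. 4.8, Remark 4.9 (p. 660)] -/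
theorem Polarization.hodgeGroupBaseChange_ne_and_mumfordTateGroupBaseChange_ne_of_not_mem_divisorClasses (hn : Odd n) {p : ℕ}
    {x : ⋀[ℚ]^(2 * p) V} (hxB : x ∈ (H.exteriorPower (2 * p)).hodgeClasses (p * n)) (hxD : x ∉ H.divisorClasses p) :
    H.hodgeGroupBaseChange ℂ ≠ Q.lefschetzGroupBaseChange ℂ ∧
      H.mumfordTateGroupBaseChange ℂ ≠ Q.lefschetzSimilitudeGroupBaseChange ℂ :=
  ⟨fun h ↦ hxD ((Q.divisorClasses_eq_hodgeClasses_of_hodgeGroupBaseChange_eq hn h p).symm ▸ hxB),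
    fun h ↦ hxD ((Q.divisorClasses_eq_hodgeClasses_of_mumfordTateGroupBaseChange_eq hn h p).symm ▸ hxB)⟩

end PropositionFourEight

end HodgeStructure

end Literature.AlgebraicGeometry.Motives

end
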